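import Mathlib.Analysis.SpecialFunctions.Trigonometric.Basic
import Mathlib.Analysis.SpecialFunctions.Trigonometric.Deriv
import Mathlib.Analysis.Calculus.Deriv.MeanValue
import Mathlib.Analysis.Calculus.Deriv.Shift
import Mathlib.Analysis.Calculus.MeanValue
import Mathlib.Algebra.Order.ToIntervalMod
import Mathlib.Algebra.BigOperators.Field
import Literature.Probability.LatticeModels.FejerKernel
import HarnessLib

/-!
# Fejér means of the square wave: sine polynomials of sup-norm `≤ 1` with first coefficient `→ 4/π`

Topic `Literature/Analysis/Fourier`. Everything here is PROVED (definitions + theorems, no named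
facts).

The square wave `sgn(sin x)` has Fourier series `(4/π) ∑_{k odd} sin(kx)/k`; its Fejér (Cesàro)
means
  `r_J(x) = (4/π) ∑_{2j+1 ≤ J} (1 − (2j+1)/(J+1)) sin((2j+1)x)/(2j+1)`  (`fejerSquareWave J x`)
are odd sine polynomials with `|r_J(x)| ≤ 1` for ALL `x` (no Gibbs overshoot: the Fejér kernel is
nonnegative) and first coefficient `(4/π) J/(J+1) → 4/π`. They solve, up to `ε`, the extremal problem
"maximise the coefficient of `sin x` among sine polynomials bounded by `1`" (supremum `4/π`, the
first Fourier coefficient of the square wave), which is the source of the constant `4/π` in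
Montgomery's theorem on zeros of the sections of `ζ` (Montgomery 1983: `b̂_δ(1) − b̂_δ(0) − 1 → 4/π − 1`;
Montgomery–Vaughan 2001, Lemma 2: `I(y) = ∫_0^y |sin u| du = (2/π) y + O(1)`). This file is the
trigonometric input of the tree's proof of `Montgomery1983_theorem`
(`Literature/Barriers/RiemannHypothesis/TuranPartialSums.lean`), where `r_J` shapes a completely
multiplicative twist of `ζ_N`.

## Main results

* `fejerKernelSum J x = (J+1) + 2 ∑_{k<J} (J − k) cos((k+1)x)`, the cosine form of `(J+1) ×` the
  Fejér kernel: it is LINKED to the tree's kernel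
  `Literature.Probability.LatticeModels.fejerKernel (J+1) x = ‖∑_{k ≤ J} e^{ikx}‖²/(J+1)` (the survivor,
  also used by `ErdosTuranDiscrepancy.lean`) by `fejerKernelSum_eq_mul_fejerKernel :
  fejerKernelSum J x = (J+1) · fejerKernel (J+1) x` (via the expansion of `‖Σ e^{ikx}‖²`); the closed
  form `(1 − cos x) · fejerKernelSum J x = 1 − cos((J+1)x)` (`fejerKernelSum_closed_form`) gives
  `0 ≤ fejerKernelSum J x` independently (`fejerKernelSum_nonneg`), and `fejerKernelSum_le` is the crude
  bound `≤ 3 (J+1)²`.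
* `fejerPrimitive J x = x + 2 ∑_{k<J} (J−k)/((J+1)(k+1)) sin((k+1)x)`, the primitive of the Fejér
  kernel, is monotone with `fejerPrimitive J 0 = 0`, `fejerPrimitive J (±π) = ±π`.
* `fejerSquareWave J x = (fejerPrimitive J x − fejerPrimitive J (x − π) − π)/π`
  (`fejerSquareWave_eq_primitive`), hence **`|fejerSquareWave J x| ≤ 1`**
  (`abs_fejerSquareWave_le_one`); it is odd (`fejerSquareWave_neg`), `2π`-periodic
  (`fejerSquareWave_add_int_mul_two_pi`), Lipschitz with the crude constant `3(J+1)/π`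
  (`abs_fejerSquareWave_sub_le`), and its coefficient of `sin x` is `(4/π) J/(J+1)`
  (`fejerSqCoeff_zero`).

## References

* [ZygmundFefferman2003] A. Zygmund, *Trigonometric Series*, 3rd ed. (with a foreword by
  R. Fefferman), Cambridge 2003, Vol. I, Ch. III §1 (1.4) and §3, (3.1)–(3.4) and Thm. (3.4)
  (Fejér's theorem; positivity of the kernel); L. Fejér, Math. Ann. 58 (1904), 51–69.
* H. L. Montgomery, *Zeros of approximations to the zeta function* (1983), §3 (the function `b_δ`,
  (12)–(13), Lemma 1).
-/

noncomputable section

open Real Finset Set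

namespace Literature.Analysis.Fourier

/-! ### The Fejér kernel in cosine form and its closed form -/

/-- `(J+1) ×` the Fejér kernel of order `J`, in cosine form:
`Φ_J(x) = (J+1) + 2 ∑_{k<J} (J − k) cos((k+1)x) = ∑_{|n| ≤ J} (J + 1 − |n|) e^{inx}`.
[cite: ZygmundFefferman2003, Ch. III (3.2)] -/
def fejerKernelSum (J : ℕ) (x : ℝ) : ℝ :=
  (J + 1 : ℝ) + 2 * ∑ k ∈ range J, ((J : ℝ) - k) * cos ((k + 1 : ℝ) * x)

/-- The step `Φ_{J+1} − Φ_J = 1 + 2 ∑_{k ≤ J} cos((k+1)x)` (a Dirichlet kernel). [folklore] -/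
theorem fejerKernelSum_succ_sub (J : ℕ) (x : ℝ) :
    fejerKernelSum (J + 1) x - fejerKernelSum J x = 1 + 2 * ∑ k ∈ range (J + 1), cos ((k + 1 : ℝ) * x) := by
  unfold fejerKernelSum
  rw [sum_range_succ, sum_range_succ]
  have h : ∑ k ∈ range J, (((J + 1 : ℕ) : ℝ) - k) * cos ((k + 1 : ℝ) * x) =
      ∑ k ∈ range J, ((J : ℝ) - k) * cos ((k + 1 : ℝ) * x) + ∑ k ∈ range J, cos ((k + 1 : ℝ) * x) := by
    rw [← sum_add_distrib]
    refine sum_congr rfl fun k _ ↦ ?_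
    push_cast; ring
  rw [h]
  push_cast
  ring

/-- **Closed form of the Fejér kernel**: `(1 − cos x) Φ_J(x) = 1 − cos((J+1)x)`.
[cite: ZygmundFefferman2003, Ch. III (3.2)–(3.3)] -/
theorem fejerKernelSum_closed_form (J : ℕ) (x : ℝ) :
    (1 - cos x) * fejerKernelSum J x = 1 - cos ((J + 1 : ℝ) * x) := by
  induction J with
  | zero => simp [fejerKernelSum]
  | succ J ih =>
    have hstep : (1 - cos x) * fejerKernelSum (J + 1) x =
        (1 - cos x) * fejerKernelSum J x + (1 - cos x) * (1 + 2 * ∑ k ∈ range (J + 1), cos ((k + 1 : ℝ) * x)) := by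
      rw [← mul_add, ← fejerKernelSum_succ_sub]; ring
    rw [hstep, ih]
    -- telescoping: `(1 − cos x)·2cos((k+1)x) = D_{k+1} − D_k`, `D_k = cos(kx) − cos((k+1)x)`
    set D : ℕ → ℝ := fun k ↦ cos ((k : ℝ) * x) - cos ((k + 1 : ℝ) * x) with hD
    have hterm : ∀ k : ℕ, (1 - cos x) * (2 * cos ((k + 1 : ℝ) * x)) = D (k + 1) - D k := by
      intro k
      simp only [hD]
      have h1 : cos ((k + 1 + 1 : ℝ) * x) = cos (((k : ℝ) + 1) * x + x) := by ring_nf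
      have h2 : cos ((k : ℝ) * x) = cos (((k : ℝ) + 1) * x - x) := by ring_nf
      push_cast
      rw [h1, h2, cos_add, cos_sub]
      ring
    have hsum : (1 - cos x) * (2 * ∑ k ∈ range (J + 1), cos ((k + 1 : ℝ) * x)) = D (J + 1) - D 0 := by
      calc (1 - cos x) * (2 * ∑ k ∈ range (J + 1), cos ((k + 1 : ℝ) * x))
          = ∑ k ∈ range (J + 1), (1 - cos x) * (2 * cos ((k + 1 : ℝ) * x)) := by
            rw [Finset.mul_sum, Finset.mul_sum]
        _ = ∑ k ∈ range (J + 1), (D (k + 1) - D k) := sum_congr rfl fun k _ ↦ hterm k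
        _ = D (J + 1) - D 0 := sum_range_sub D (J + 1)
    have hD0 : D 0 = 1 - cos x := by simp [hD]
    have hDJ : D (J + 1) = cos (((J : ℝ) + 1) * x) - cos (((J : ℝ) + 1 + 1) * x) := by
      simp only [hD]; push_cast; ring_nf
    rw [mul_add, mul_one, hsum, hD0, hDJ]
    push_cast
    ring

/-- **Positivity of the Fejér kernel**: `0 ≤ Φ_J(x)`. [cite: ZygmundFefferman2003, Ch. III (3.3)] -/
theorem fejerKernelSum_nonneg (J : ℕ) (x : ℝ) : 0 ≤ fejerKernelSum J x := by
  rcases (cos_le_one x).lt_or_eq with h | h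
  · have h1 := fejerKernelSum_closed_form J x
    have h2 : 0 ≤ (1 - cos x) * fejerKernelSum J x := by
      rw [h1]; linarith [cos_le_one ((J + 1 : ℝ) * x)]
    exact (mul_nonneg_iff_of_pos_left (by linarith)).1 h2
  · -- `cos x = 1`: `x ∈ 2πℤ` and every cosine is `1`
    obtain ⟨n, hn⟩ := (cos_eq_one_iff x).1 h
    have hk : ∀ k : ℕ, cos ((k + 1 : ℝ) * x) = 1 := fun k ↦ by
      rw [cos_eq_one_iff]
      exact ⟨(k + 1) * n, by rw [← hn]; push_cast; ring⟩
    unfold fejerKernelSum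
    have hs : 0 ≤ ∑ k ∈ range J, ((J : ℝ) - k) * cos ((k + 1 : ℝ) * x) := by
      refine sum_nonneg fun k hk' ↦ ?_
      rw [hk k, mul_one]
      have : (k : ℝ) < J := by exact_mod_cast mem_range.1 hk'
      linarith
    positivity

/-- A crude upper bound: `Φ_J(x) ≤ 3 (J+1)²`. [folklore] -/
theorem fejerKernelSum_le (J : ℕ) (x : ℝ) : fejerKernelSum J x ≤ 3 * ((J : ℝ) + 1) ^ 2 := by
  unfold fejerKernelSum
  have hs : ∑ k ∈ range J, ((J : ℝ) - k) * cos ((k + 1 : ℝ) * x) ≤ ∑ k ∈ range J, (J : ℝ) := by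
    refine sum_le_sum fun k hk ↦ ?_
    have hk' : (k : ℝ) < J := by exact_mod_cast mem_range.1 hk
    have hc := abs_cos_le_one ((k + 1 : ℝ) * x)
    have : |((J : ℝ) - k) * cos ((k + 1 : ℝ) * x)| ≤ (J : ℝ) - k := by
      rw [abs_mul, abs_of_nonneg (by linarith : (0 : ℝ) ≤ J - k)]
      exact mul_le_of_le_one_right (by linarith) hc
    have hk0 : (0 : ℝ) ≤ k := Nat.cast_nonneg k
    linarith [le_abs_self (((J : ℝ) - k) * cos ((k + 1 : ℝ) * x))]
  rw [sum_const, card_range, nsmul_eq_mul] at hs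
  nlinarith

/-- The Fejér kernel sum is continuous. [folklore] -/
theorem continuous_fejerKernelSum (J : ℕ) : Continuous (fejerKernelSum J) := by
  unfold fejerKernelSum; fun_prop

/-- The double cosine sum `∑_{k,l ≤ J} cos((k−l)x)` satisfies the same recursion as `Φ_J`:
grouping by `k − l` it IS `Φ_J`. [cite: ZygmundFefferman2003, Ch. III (3.2)] -/
theorem double_sum_cos_eq_fejerKernelSum (J : ℕ) (x : ℝ) :
    ∑ k ∈ range (J + 1), ∑ l ∈ range (J + 1), cos (((k : ℝ) - l) * x) = fejerKernelSum J x := by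
  induction J with
  | zero => simp [fejerKernelSum]
  | succ J ih =>
    -- peel off the last row and the last column
    rw [sum_range_succ, sum_congr rfl (fun k _ ↦ sum_range_succ _ _), sum_add_distrib, ih]
    -- the new terms: `Σ_{k≤J} cos((k−(J+1))x) + Σ_{l≤J} cos((J+1−l)x) + cos 0`
    have hrefl : ∑ l ∈ range (J + 1), cos ((((J + 1 : ℕ) : ℝ) - l) * x) =
        ∑ m ∈ range (J + 1), cos ((m + 1 : ℝ) * x) := by
      rw [← sum_range_reflect (fun m ↦ cos ((m + 1 : ℝ) * x)) (J + 1)]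
      refine sum_congr rfl fun l hl ↦ ?_
      have hl' : l ≤ J := Nat.lt_succ_iff.1 (mem_range.1 hl)
      simp only [add_tsub_cancel_right]
      rw [Nat.cast_sub hl']
      push_cast; ring_nf
    have hcol : ∑ k ∈ range (J + 1), cos (((k : ℝ) - ((J + 1 : ℕ) : ℝ)) * x) =
        ∑ m ∈ range (J + 1), cos ((m + 1 : ℝ) * x) := by
      rw [← hrefl]
      refine sum_congr rfl fun k _ ↦ ?_
      rw [← cos_neg]; ring_nf
    have hdiag : cos ((((J + 1 : ℕ) : ℝ) - ((J + 1 : ℕ) : ℝ)) * x) = 1 := by simp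
    have hrow : ∑ l ∈ range (J + 1 + 1), cos ((((J + 1 : ℕ) : ℝ) - l) * x) =
        ∑ m ∈ range (J + 1), cos ((m + 1 : ℝ) * x) + 1 := by
      rw [sum_range_succ, hdiag, hrefl]
    rw [hcol, hrow]
    have := fejerKernelSum_succ_sub J x
    linarith

/-- `‖Σ_{k < L} e^{iku}‖² = Σ_{k,l < L} cos((k−l)u)` for the tree's Dirichlet sum
`Literature.Probability.LatticeModels.dirichletSum` (expand `z z̄`; the same computation as
`Literature.Analysis.Fourier.norm_dirichletSum_sq_eq_double_sum` of `ErdosTuranDiscrepancy.lean`,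
repeated here to keep the import light). [folklore] -/
theorem norm_dirichletSum_sq_eq_double_sum' (L : ℕ) (u : ℝ) :
    ‖Literature.Probability.LatticeModels.dirichletSum L u‖ ^ 2 =
      ∑ k ∈ range L, ∑ l ∈ range L, Real.cos (((k : ℝ) - l) * u) := by
  set z : ℂ := Literature.Probability.LatticeModels.dirichletSum L u with hz
  have h1 : ((‖z‖ ^ 2 : ℝ) : ℂ) = (starRingEnd ℂ) z * z := by
    rw [← Complex.normSq_eq_norm_sq, Complex.normSq_eq_conj_mul_self]
  have h2 : (starRingEnd ℂ) z * z =
      ∑ k ∈ range L, ∑ l ∈ range L,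
        Complex.exp (((((k : ℝ) - l) * u : ℝ) : ℂ) * Complex.I) := by
    rw [hz, Literature.Probability.LatticeModels.dirichletSum, map_sum, Finset.sum_mul_sum, Finset.sum_comm]
    refine Finset.sum_congr rfl fun k _ => Finset.sum_congr rfl fun l _ => ?_
    rw [← Complex.exp_conj, ← Complex.exp_add]
    congr 1
    simp only [map_mul, Complex.conj_I, Complex.conj_ofReal]
    push_cast
    ring
  have h3 := congrArg Complex.re (h1.trans h2)
  rw [Complex.ofReal_re] at h3
  rw [h3, Complex.re_sum]
  refine Finset.sum_congr rfl fun k _ => ?_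
  rw [Complex.re_sum]
  refine Finset.sum_congr rfl fun l _ => ?_
  exact Complex.exp_ofReal_mul_I_re _

/-- **Link with the tree's Fejér kernel**: `fejerKernelSum J x = (J+1) · fejerKernel (J+1) x` for
`Literature.Probability.LatticeModels.fejerKernel (J+1) x = ‖∑_{k ≤ J} e^{ikx}‖²/(J+1)` (the kernel of
`Literature/Probability/LatticeModels/FejerKernel.lean`, the one to use — also in
`ErdosTuranDiscrepancy.lean`; `fejerKernelSum` is merely its cosine form, convenient for calculus).
[folklore] -/
theorem fejerKernelSum_eq_mul_fejerKernel (J : ℕ) (x : ℝ) :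
    fejerKernelSum J x = ((J : ℝ) + 1) * Literature.Probability.LatticeModels.fejerKernel (J + 1) x := by
  rw [Literature.Probability.LatticeModels.fejerKernel, norm_dirichletSum_sq_eq_double_sum',
    double_sum_cos_eq_fejerKernelSum]
  push_cast
  field_simp

/-! ### The primitive of the kernel -/

/-- The primitive of the Fejér kernel `F_J = Φ_J/(J+1)` vanishing at `0`:
`G_J(x) = x + 2 ∑_{k<J} (J−k)/((J+1)(k+1)) sin((k+1)x)`. [folklore] -/
def fejerPrimitive (J : ℕ) (x : ℝ) : ℝ :=
  x + 2 * ∑ k ∈ range J, ((J : ℝ) - k) / (((J : ℝ) + 1) * ((k : ℝ) + 1)) * sin ((k + 1 : ℝ) * x)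

/-- `G_J' = Φ_J/(J+1)`. [folklore] -/
theorem hasDerivAt_fejerPrimitive (J : ℕ) (x : ℝ) :
    HasDerivAt (fejerPrimitive J) (fejerKernelSum J x / ((J : ℝ) + 1)) x := by
  have hJ : (0 : ℝ) < (J : ℝ) + 1 := by positivity
  have hterm : ∀ k ∈ range J, HasDerivAt
      (fun y : ℝ ↦ ((J : ℝ) - k) / (((J : ℝ) + 1) * ((k : ℝ) + 1)) * sin ((k + 1 : ℝ) * y))
      (((J : ℝ) - k) / (((J : ℝ) + 1) * ((k : ℝ) + 1)) * (cos ((k + 1 : ℝ) * x) * ((k + 1 : ℝ) * 1))) x := by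
    intro k _
    exact (((hasDerivAt_id x).const_mul ((k : ℝ) + 1)).sin).const_mul _
  have h := (hasDerivAt_id x).fun_add ((HasDerivAt.fun_sum hterm).const_mul (2 : ℝ))
  have hfun : fejerPrimitive J = fun y ↦ id y + 2 * ∑ k ∈ range J,
      ((J : ℝ) - k) / (((J : ℝ) + 1) * ((k : ℝ) + 1)) * sin ((k + 1 : ℝ) * y) := by
    funext y; rfl
  rw [hfun]
  refine h.congr_deriv ?_
  unfold fejerKernelSum
  rw [add_div, div_self hJ.ne', mul_div_assoc, Finset.sum_div]
  congr 2
  refine sum_congr rfl fun k _ ↦ ?_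
  have hk : (0 : ℝ) < (k : ℝ) + 1 := by positivity
  field_simp

/-- `G_J` is differentiable. [folklore] -/
theorem differentiable_fejerPrimitive (J : ℕ) : Differentiable ℝ (fejerPrimitive J) :=
  fun x ↦ (hasDerivAt_fejerPrimitive J x).differentiableAt

/-- `G_J` is nondecreasing (its derivative is the nonnegative Fejér kernel).
[cite: ZygmundFefferman2003, Ch. III Thm. (3.4)] -/
theorem monotone_fejerPrimitive (J : ℕ) : Monotone (fejerPrimitive J) :=
  monotone_of_deriv_nonneg (differentiable_fejerPrimitive J) fun x ↦ by
    rw [(hasDerivAt_fejerPrimitive J x).deriv]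
    exact div_nonneg (fejerKernelSum_nonneg J x) (by positivity)

/-- `G_J(0) = 0`. [folklore] -/
theorem fejerPrimitive_zero (J : ℕ) : fejerPrimitive J 0 = 0 := by simp [fejerPrimitive]

/-- `G_J(x − mπ) = G_J-type sum with signs`: the sines at multiples of `π` vanish, so
`G_J(π) = π` and `G_J(−π) = −π`. [folklore] -/
theorem fejerPrimitive_pi (J : ℕ) : fejerPrimitive J π = π := by
  unfold fejerPrimitive
  have : ∀ k ∈ range J, ((J : ℝ) - k) / (((J : ℝ) + 1) * ((k : ℝ) + 1)) * sin ((k + 1 : ℝ) * π) = 0 := by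
    intro k _
    have h : sin ((k + 1 : ℝ) * π) = 0 := by exact_mod_cast sin_nat_mul_pi (k + 1)
    rw [h, mul_zero]
  rw [sum_congr rfl this]; simp

/-- `G_J(−π) = −π`. [folklore] -/
theorem fejerPrimitive_neg_pi (J : ℕ) : fejerPrimitive J (-π) = -π := by
  unfold fejerPrimitive
  have : ∀ k ∈ range J, ((J : ℝ) - k) / (((J : ℝ) + 1) * ((k : ℝ) + 1)) * sin ((k + 1 : ℝ) * -π) = 0 := by
    intro k _
    have h : sin ((k + 1 : ℝ) * π) = 0 := by exact_mod_cast sin_nat_mul_pi (k + 1)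
    rw [mul_neg, sin_neg, h, neg_zero, mul_zero]
  rw [sum_congr rfl this]; simp

/-! ### The Fejér means of the square wave -/

/-- The coefficients `c_{J,j} = (J − 2j)/((J+1)(2j+1)) = (1 − (2j+1)/(J+1))/(2j+1)` of the Fejér mean
of the square wave (for `2j + 1 ≤ J`). [cite: ZygmundFefferman2003, Ch. III (1.4) and §3] -/
def fejerSqCoeff (J j : ℕ) : ℝ := ((J : ℝ) - 2 * j) / (((J : ℝ) + 1) * (2 * j + 1))

/-- **The Fejér means of the square wave** `sgn(sin x) ~ (4/π) ∑_{k odd} sin(kx)/k`: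
`r_J(x) = (4/π) ∑_{2j+1 ≤ J} (1 − (2j+1)/(J+1)) sin((2j+1)x)/(2j+1)`.
[cite: ZygmundFefferman2003, Ch. III §3] -/
def fejerSquareWave (J : ℕ) (x : ℝ) : ℝ :=
  4 / π * ∑ j ∈ range ((J + 1) / 2), fejerSqCoeff J j * sin ((2 * j + 1 : ℝ) * x)

/-- The coefficient of `sin x` is `(4/π) · J/(J+1)`: `fejerSqCoeff J 0 = J/(J+1)`. [folklore] -/
theorem fejerSqCoeff_zero (J : ℕ) : fejerSqCoeff J 0 = (J : ℝ) / ((J : ℝ) + 1) := by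
  simp [fejerSqCoeff]

/-- The coefficients are nonnegative for `2j + 1 ≤ J` and at most `1/(2j+1)`. [folklore] -/
theorem fejerSqCoeff_nonneg {J j : ℕ} (hj : j ∈ range ((J + 1) / 2)) : 0 ≤ fejerSqCoeff J j := by
  have h := mem_range.1 hj
  have h2 : 2 * j + 1 ≤ J := by omega
  have h3 : (2 * j + 1 : ℝ) ≤ J := by exact_mod_cast h2
  unfold fejerSqCoeff
  exact div_nonneg (by linarith) (by positivity)

/-- `c_{J,j} ≤ 1/(2j+1)`. [folklore] -/
theorem fejerSqCoeff_le {J j : ℕ} : fejerSqCoeff J j ≤ 1 / (2 * j + 1) := by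
  unfold fejerSqCoeff
  rw [div_le_div_iff₀ (by positivity) (by positivity), one_mul]
  have : (0 : ℝ) ≤ j := Nat.cast_nonneg j
  nlinarith

/-- Parity bookkeeping: `∑_{k<J} (1 − (−1)^{k+1}) f(k) = 2 ∑_{j<(J+1)/2} f(2j)`. [folklore] -/
theorem sum_range_one_sub_neg_one_pow (f : ℕ → ℝ) (J : ℕ) :
    ∑ k ∈ range J, (1 - (-1 : ℝ) ^ (k + 1)) * f k = 2 * ∑ j ∈ range ((J + 1) / 2), f (2 * j) := by
  induction J with
  | zero => simp
  | succ J ih =>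
    rw [sum_range_succ, ih]
    rcases Nat.even_or_odd J with ⟨m, hm⟩ | ⟨m, hm⟩
    · -- `J = 2m` even: the new term is `2 f(J)` and `(J+2)/2 = m + 1`
      subst hm
      have h1 : (m + m + 1) / 2 = m := by omega
      have h2 : (m + m + 1 + 1) / 2 = m + 1 := by omega
      rw [h1, h2, sum_range_succ, show m + m = 2 * m by ring]
      have h3 : (-1 : ℝ) ^ (2 * m + 1) = -1 := by
        rw [pow_succ, pow_mul]; norm_num
      rw [h3]; ring
    · -- `J = 2m+1` odd: the new term vanishes and `(J+2)/2 = (J+1)/2 = m + 1`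
      subst hm
      have h1 : (2 * m + 1 + 1) / 2 = m + 1 := by omega
      have h2 : (2 * m + 1 + 1 + 1) / 2 = m + 1 := by omega
      rw [h1, h2]
      have h3 : (-1 : ℝ) ^ (2 * m + 1 + 1) = 1 := by
        rw [show 2 * m + 1 + 1 = 2 * (m + 1) by ring, pow_mul]; norm_num
      rw [h3]; ring

/-- **The primitive representation**: `r_J(x) = (G_J(x) − G_J(x − π) − π)/π` (`G_J` the primitive
of the Fejér kernel), i.e. `r_J(x) = (1/π)(∫_0^x F_J − ∫_{−π}^{x−π} F_J)`: the Fejér mean of the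
square wave is the convolution of `sgn(sin)` with the kernel. [cite: ZygmundFefferman2003, Ch. III (3.1)–(3.2)] -/
theorem fejerSquareWave_eq_primitive (J : ℕ) (x : ℝ) :
    fejerSquareWave J x = (fejerPrimitive J x - fejerPrimitive J (x - π) - π) / π := by
  have hπ : π ≠ 0 := pi_ne_zero
  -- the sines at `x − π`
  have hsin : ∀ k : ℕ, sin ((k + 1 : ℝ) * (x - π)) = (-1 : ℝ) ^ (k + 1) * sin ((k + 1 : ℝ) * x) := by
    intro k
    have := sin_sub_nat_mul_pi ((k + 1 : ℝ) * x) (k + 1)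
    push_cast at this
    rw [← this]; ring_nf
  have hdiff : fejerPrimitive J x - fejerPrimitive J (x - π) - π =
      2 * ∑ k ∈ range J, (1 - (-1 : ℝ) ^ (k + 1)) *
        (((J : ℝ) - k) / (((J : ℝ) + 1) * ((k : ℝ) + 1)) * sin ((k + 1 : ℝ) * x)) := by
    unfold fejerPrimitive
    rw [mul_sum, mul_sum, mul_sum]
    have : ∀ k ∈ range J, 2 * (((J : ℝ) - k) / (((J : ℝ) + 1) * ((k : ℝ) + 1)) * sin ((k + 1 : ℝ) * (x - π))) =
        2 * (((J : ℝ) - k) / (((J : ℝ) + 1) * ((k : ℝ) + 1)) * sin ((k + 1 : ℝ) * x)) -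
        2 * ((1 - (-1 : ℝ) ^ (k + 1)) * (((J : ℝ) - k) / (((J : ℝ) + 1) * ((k : ℝ) + 1)) * sin ((k + 1 : ℝ) * x))) := by
      intro k _; rw [hsin k]; ring
    rw [sum_congr rfl this, sum_sub_distrib]
    ring
  rw [hdiff, sum_range_one_sub_neg_one_pow, fejerSquareWave]
  rw [eq_div_iff hπ, mul_sum, mul_sum, mul_sum, sum_mul]
  refine sum_congr rfl fun j _ ↦ ?_
  unfold fejerSqCoeff
  push_cast
  field_simp
  ring

/-- **No Gibbs overshoot on `[0, π]`**: `−1 ≤ r_J(x) ≤ 1` for `0 ≤ x ≤ π`, from the monotonicity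
of `G_J` and `G_J(0) = 0`, `G_J(±π) = ±π`. [cite: ZygmundFefferman2003, Ch. III Thm. (3.4)] -/
theorem abs_fejerSquareWave_le_one_of_mem_Icc (J : ℕ) {x : ℝ} (hx : x ∈ Icc 0 π) :
    |fejerSquareWave J x| ≤ 1 := by
  rw [fejerSquareWave_eq_primitive]
  have hm := monotone_fejerPrimitive J
  have h1 : fejerPrimitive J x ≤ π := (hm hx.2).trans_eq (fejerPrimitive_pi J)
  have h2 : 0 ≤ fejerPrimitive J x := (fejerPrimitive_zero J).symm.le.trans (hm hx.1)
  have h3 : -π ≤ fejerPrimitive J (x - π) :=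
    (fejerPrimitive_neg_pi J).symm.le.trans (hm (by linarith [hx.1]))
  have h4 : fejerPrimitive J (x - π) ≤ 0 :=
    (hm (by linarith [hx.2] : x - π ≤ 0)).trans_eq (fejerPrimitive_zero J)
  rw [abs_le, le_div_iff₀ pi_pos, div_le_iff₀ pi_pos]
  constructor <;> linarith

/-- `r_J` is odd. [folklore] -/
theorem fejerSquareWave_neg (J : ℕ) (x : ℝ) : fejerSquareWave J (-x) = -fejerSquareWave J x := by
  unfold fejerSquareWave
  rw [← mul_neg, ← sum_neg_distrib]
  congr 1
  refine sum_congr rfl fun j _ ↦ ?_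
  rw [mul_neg, sin_neg, mul_neg]

/-- `r_J` is `2π`-periodic (integer multiples). [folklore] -/
theorem fejerSquareWave_add_int_mul_two_pi (J : ℕ) (x : ℝ) (n : ℤ) :
    fejerSquareWave J (x + n * (2 * π)) = fejerSquareWave J x := by
  unfold fejerSquareWave
  congr 1
  refine sum_congr rfl fun j _ ↦ ?_
  have : (2 * j + 1 : ℝ) * (x + n * (2 * π)) = (2 * j + 1 : ℝ) * x + ((2 * j + 1) * n : ℤ) * (2 * π) := by
    push_cast; ring
  rw [this, sin_add_int_mul_two_pi]

/-- **`|r_J(x)| ≤ 1` for all real `x`** (Fejér: the Cesàro means of a Fourier series are bounded by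
the sup of the function). [cite: ZygmundFefferman2003, Ch. III Thm. (3.4)] -/
theorem abs_fejerSquareWave_le_one (J : ℕ) (x : ℝ) : |fejerSquareWave J x| ≤ 1 := by
  have h2π : (0 : ℝ) < 2 * π := by positivity
  -- reduce modulo `2π` to `[0, 2π)`
  set x₀ : ℝ := toIcoMod h2π 0 x with hx₀
  have hmem : x₀ ∈ Ico 0 (0 + 2 * π) := toIcoMod_mem_Ico h2π 0 x
  have hx : x = x₀ + (toIcoDiv h2π 0 x : ℤ) * (2 * π) := by
    have := (toIcoMod_add_toIcoDiv_zsmul h2π 0 x).symm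
    rwa [zsmul_eq_mul] at this
  rw [hx, fejerSquareWave_add_int_mul_two_pi]
  rcases le_or_gt x₀ π with h | h
  · exact abs_fejerSquareWave_le_one_of_mem_Icc J ⟨hmem.1, h⟩
  · -- `x₀ ∈ (π, 2π)`: use `r(x₀) = r(x₀ − 2π) = −r(2π − x₀)`
    have h' : x₀ < 2 * π := by simpa using hmem.2
    have e : x₀ = -(2 * π - x₀) + (1 : ℤ) * (2 * π) := by push_cast; ring
    rw [e, fejerSquareWave_add_int_mul_two_pi, fejerSquareWave_neg, abs_neg]
    exact abs_fejerSquareWave_le_one_of_mem_Icc J ⟨by linarith, by linarith⟩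

/-- `r_J` is differentiable with `r_J' = (Φ_J(x) − Φ_J(x − π))/((J+1)π)`. [folklore] -/
theorem hasDerivAt_fejerSquareWave (J : ℕ) (x : ℝ) :
    HasDerivAt (fejerSquareWave J)
      ((fejerKernelSum J x - fejerKernelSum J (x - π)) / (((J : ℝ) + 1) * π)) x := by
  have h1 := hasDerivAt_fejerPrimitive J x
  have h2 : HasDerivAt (fun y ↦ fejerPrimitive J (y - π)) (fejerKernelSum J (x - π) / ((J : ℝ) + 1)) x :=
    HasDerivAt.comp_sub_const x π (hasDerivAt_fejerPrimitive J (x - π))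
  have h3 := ((h1.fun_sub h2).sub_const π).div_const π
  have heq : (fun y ↦ (fejerPrimitive J y - fejerPrimitive J (y - π) - π) / π) = fejerSquareWave J := by
    funext y; rw [fejerSquareWave_eq_primitive]
  rw [heq] at h3
  refine h3.congr_deriv ?_
  field_simp

/-- **Lipschitz bound**: `|r_J(x) − r_J(y)| ≤ (3(J+1)/π) |x − y|`. [folklore] -/
theorem abs_fejerSquareWave_sub_le (J : ℕ) (x y : ℝ) :
    |fejerSquareWave J x - fejerSquareWave J y| ≤ 3 * ((J : ℝ) + 1) / π * |x - y| := by
  have hJ : (0 : ℝ) < (J : ℝ) + 1 := by positivity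
  have hbound : ∀ z : ℝ, ‖deriv (fejerSquareWave J) z‖ ≤ 3 * ((J : ℝ) + 1) / π := by
    intro z
    rw [(hasDerivAt_fejerSquareWave J z).deriv, Real.norm_eq_abs, abs_div,
      abs_of_pos (by positivity : (0 : ℝ) < ((J : ℝ) + 1) * π), div_le_div_iff₀ (by positivity) pi_pos]
    have ha := fejerKernelSum_nonneg J z
    have hb := fejerKernelSum_nonneg J (z - π)
    have ha' := fejerKernelSum_le J z
    have hb' := fejerKernelSum_le J (z - π)
    have : |fejerKernelSum J z - fejerKernelSum J (z - π)| ≤ 3 * ((J : ℝ) + 1) ^ 2 := by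
      rw [abs_le]; constructor <;> nlinarith
    have hπ := pi_pos
    calc |fejerKernelSum J z - fejerKernelSum J (z - π)| * π ≤ 3 * ((J : ℝ) + 1) ^ 2 * π :=
          mul_le_mul_of_nonneg_right this hπ.le
      _ = 3 * ((J : ℝ) + 1) * (((J : ℝ) + 1) * π) := by ring
  have h := Convex.norm_image_sub_le_of_norm_deriv_le (s := univ)
    (fun z _ ↦ (hasDerivAt_fejerSquareWave J z).differentiableAt) (fun z _ ↦ hbound z) convex_univ
    (mem_univ y) (mem_univ x)
  simpa [Real.norm_eq_abs] using h

/-- `r_J` is continuous. [folklore] -/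
theorem continuous_fejerSquareWave (J : ℕ) : Continuous (fejerSquareWave J) := by
  unfold fejerSquareWave; fun_prop

end Literature.Analysis.Fourier

end
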